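import Summits.KontsevichZagierPeriods.KontsevichZagierPeriods.Theorems.LinRedNormalFormArrangementNormalFormStubRebaseSimplePosProduct
import Summits.KontsevichZagierPeriods.KontsevichZagierPeriods.Theorems.LinRedNormalFormArrangementNormalFormStubRebaseSimplePosJanus

/-!
# Stub `stub_rebaseSimpleZero`, part `rebaseSimpleZero_nested2` (crux `ArrangementNormalForm`,
line `janus-bands`, v6.2) — brick `NestedSection`

Rebase of a NESTED pair of fibres `A(x', y) < tᵢ < tⱼ < B(x', y)` (literal `GG B σ 2` datum,
any silent base dimension `B`) whose letters have a common `y`-slope `λ`, in the SEPARABLE case: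
there is a letter-parallel section `S(x', y) = λ y + κ(x')` with `A ≤ S ≤ B` on the base cell.
Rule (1a) cuts the cell by the position of `S` among `tᵢ < tⱼ` into the three literal cells
`{A < tᵢ < tⱼ < S}`, `{A < tᵢ < S} × {S < tⱼ < B}`, `{S < tᵢ < tⱼ < B}` (the level sets
`tᵢ = S`, `tⱼ = S` are null); on each, ONE per-fibre affine pull-back (`RebasePos.pull`: shear
both fibres along `λ`, rescale the unique letter-transverse bound of each linked component to the
coordinate `y` itself) lands literally in `GG B 2 2` (`RebaseNest.nestSection`, registered on the
literal class text as `rebaseSimpleZero_nestedSection`). Generic glue: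
`RebaseNest.good_of_pull`.

References: M. Kontsevich, D. Zagier, *Periods* (2001), §1.2, rules (1a), (2).
-/

noncomputable section

open Set MeasureTheory MvPolynomial
open Literature.NumberTheory.Transcendental Literature.ModelTheory.ExponentialFields

namespace Summit.KontsevichZagierPeriods.ArrangementNormalForm.JanusBands

namespace RebaseNest

open SeparatePos RebasePos

section GoodLemmas

variable {T : Set KZ.FormalRep}

/-- Members of `T` are good. [folklore] -/
theorem good_of_mem {x : KZ.FormalRep} (h : x ∈ T) : (∃ c ∈ AddSubgroup.closure T, x - c ∈ KZ.relations) :=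
  ⟨x, AddSubgroup.subset_closure h, by simp⟩

/-- Relations are good. [folklore] -/
theorem good_of_mem_relations {x : KZ.FormalRep} (h : x ∈ KZ.relations) : (∃ c ∈ AddSubgroup.closure T, x - c ∈ KZ.relations) :=
  ⟨0, zero_mem _, by simpa using h⟩

/-- Goodness passes along relations. [folklore] -/
theorem good_of_sub_mem {x y : KZ.FormalRep} (h : x - y ∈ KZ.relations) (hy : (∃ c ∈ AddSubgroup.closure T, y - c ∈ KZ.relations)) :
    (∃ c ∈ AddSubgroup.closure T, x - c ∈ KZ.relations) := by
  obtain ⟨c, hc, hyc⟩ := hy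
  refine ⟨c, hc, ?_⟩
  have := add_mem h hyc
  rwa [sub_add_sub_cancel] at this

/-- Sums of good elements are good. [folklore] -/
theorem good_add {x y : KZ.FormalRep} (hx : (∃ c ∈ AddSubgroup.closure T, x - c ∈ KZ.relations)) (hy : (∃ c ∈ AddSubgroup.closure T, y - c ∈ KZ.relations)) : (∃ c ∈ AddSubgroup.closure T, x + y - c ∈ KZ.relations) := by
  obtain ⟨c, hc, hxc⟩ := hx
  obtain ⟨d, hd, hyd⟩ := hy
  refine ⟨c + d, add_mem hc hd, ?_⟩
  have := add_mem hxc hyd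
  rwa [show x - c + (y - d) = x + y - (c + d) by abel] at this

/-- Finite sums of good elements are good. [folklore] -/
theorem good_sum {ι : Type*} (s : Finset ι) (f : ι → KZ.FormalRep) (h : ∀ i ∈ s, (∃ c ∈ AddSubgroup.closure T, f i - c ∈ KZ.relations)) :
    (∃ c ∈ AddSubgroup.closure T, ∑ i ∈ s, f i - c ∈ KZ.relations) := by
  classical
  induction s using Finset.induction_on with
  | empty => simpa using good_of_mem_relations (zero_mem _)
  | insert a s ha ih =>
    rw [Finset.sum_insert ha]
    exact good_add (h a (Finset.mem_insert_self a s)) (ih fun i hi => h i (Finset.mem_insert_of_mem hi))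

end GoodLemmas

section Pull

variable {B K m m' : ℕ}

/-- A mapped bound is affine only if it was affine. -/
theorem exists_of_map_eq_inr {u : Fin K ⊕ ((Fin (B + 1) → ℚ) × ℚ)}
    {f : (Fin (B + 1) → ℚ) × ℚ → (Fin (B + 1) → ℚ) × ℚ} {c : (Fin (B + 1) → ℚ) × ℚ}
    (h : u.map id f = Sum.inr c) : ∃ c₀, u = Sum.inr c₀ ∧ c = f c₀ := by
  cases u with
  | inl j => simp at h
  | inr c₀ =>
    simp only [Sum.map_inr, Sum.inr.injEq] at h
    exact ⟨c₀, rfl, h.symm⟩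

/-- The affine bounds after `RebasePos.pull` are the pulled-back original affine bounds. -/
theorem exists_of_pull_eq_inr (μ α : Fin K → ℚ) (δ : Fin K → (Fin B → ℚ) × ℚ)
    (lo hi : Fin K → Fin K ⊕ ((Fin (B + 1) → ℚ) × ℚ)) (l : Fin K) (c : (Fin (B + 1) → ℚ) × ℚ)
    (h : pullLo μ α δ lo hi l = Sum.inr c ∨ pullHi μ α δ lo hi l = Sum.inr c) :
    ∃ c₀, (lo l = Sum.inr c₀ ∨ hi l = Sum.inr c₀) ∧ c = pullC (μ l) (α l) (δ l) c₀ := by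
  simp only [pullLo, pullHi] at h
  split_ifs at h <;> rcases h with h | h <;> obtain ⟨c₀, h₀, hc⟩ := exists_of_map_eq_inr h
  exacts [⟨c₀, Or.inl h₀, hc⟩, ⟨c₀, Or.inr h₀, hc⟩, ⟨c₀, Or.inr h₀, hc⟩, ⟨c₀, Or.inl h₀, hc⟩]

/-- **Pull-back and package** (rules 2; literal `GG B 2 K`). If a per-fibre affine pull-back
datum `(μ, α, δ)` (linked fibres sharing their datum) shears every letter to a `y`-free one
(`αₗ` = letter slope) and sends every affine bound to a `y`-free form or to `y` itself, the
representation is good for `GG B 2 K`. [Kontsevich–Zagier 2001, §1.2, rule (2)] -/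
theorem good_of_pull {n₁ n₂ : ℕ} (s : KZ.IntegralRep (B + 1 + K))
    (M : Fin m' → (Fin (B + 1) → ℚ) × ℚ) (L : Fin m → (Fin B → ℚ) × ℚ) (e : Fin m → ℕ)
    (p : MvPolynomial (Fin B) ℚ) (ℓ₁ ℓ₂ : (Fin B → ℚ) × ℚ)
    (a : Fin K → Option ((Fin (B + 1) → ℚ) × ℚ)) (lo hi : Fin K → Fin K ⊕ ((Fin (B + 1) → ℚ) × ℚ))
    (h12 : n₁ = 0 ∨ n₂ = 0) (hbd : Bornology.IsBounded s.domain) (hdom : s.domain = gDom B K m' M lo hi)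
    (hint : EqOn s.integrand (glit B K p L e ℓ₁ ℓ₂ n₁ n₂ a) s.domain)
    (μ α : Fin K → ℚ) (δ : Fin K → (Fin B → ℚ) × ℚ) (hμ : ∀ l, μ l ≠ 0)
    (hlink : ∀ l l', (lo l = Sum.inl l' ∨ hi l = Sum.inl l') → μ l = μ l' ∧ α l = α l' ∧ δ l = δ l')
    (hA : ∀ l c, a l = some c → c.1 (Fin.last B) = α l)
    (hBnd : ∀ l c, (lo l = Sum.inr c ∨ hi l = Sum.inr c) →
      ((pullC (μ l) (α l) (δ l) c).1 (Fin.last B) = 0 ∨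
        pullC (μ l) (α l) (δ l) c = (Pi.single (Fin.last B) 1, 0))) :
    (∃ c ∈ AddSubgroup.closure (GGset B 2 K), KZ.of s - c ∈ KZ.relations) := by
  obtain ⟨s', -, hbd', hdom', hint', hrel⟩ :=
    pull μ α δ s M L e p ℓ₁ ℓ₂ n₁ n₂ a lo hi hbd hdom hint hμ hlink
  refine good_of_sub_mem hrel (good_of_mem (mem_GGset_two s' M L e _ ℓ₁ ℓ₂ _ _ _ h12
    (fun l c hc => ?_) (fun l c hc => ?_) hbd' hdom' hint'))
  · rcases h : a l with _ | c₀
    · simp [pullA, h] at hc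
    · simp only [pullA, h, Option.map_some, Option.some.injEq] at hc
      rw [← hc, pullC_fst_last, hA l c₀ h, sub_self, zero_div]
  · obtain ⟨c₀, h₀, rfl⟩ := exists_of_pull_eq_inr μ α δ lo hi l c hc
    exact hBnd l c₀ h₀

/-- A letter-parallel form is pulled back to a `y`-free form (any datum with shear `λ`). -/
theorem piv_par (μ lam : ℚ) (δ : (Fin B → ℚ) × ℚ) (c : (Fin (B + 1) → ℚ) × ℚ)
    (hc : c.1 (Fin.last B) = lam) : (pullC μ lam δ c).1 (Fin.last B) = 0 := by
  rw [pullC_fst_last, hc, sub_self, zero_div]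

/-- **One pivot.** If all letters have `y`-slope `λ` and every affine bound is either the single
form `P` or `λ`-parallel, the representation is good for `GG B 2 K` (one joint pull-back; linked
fibres allowed). [Kontsevich–Zagier 2001, §1.2, rule (2)] -/
theorem good_pivot {n₁ n₂ : ℕ} (s : KZ.IntegralRep (B + 1 + K))
    (M : Fin m' → (Fin (B + 1) → ℚ) × ℚ) (L : Fin m → (Fin B → ℚ) × ℚ) (e : Fin m → ℕ)
    (p : MvPolynomial (Fin B) ℚ) (ℓ₁ ℓ₂ : (Fin B → ℚ) × ℚ)
    (a : Fin K → Option ((Fin (B + 1) → ℚ) × ℚ)) (lo hi : Fin K → Fin K ⊕ ((Fin (B + 1) → ℚ) × ℚ))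
    (h12 : n₁ = 0 ∨ n₂ = 0) (hbd : Bornology.IsBounded s.domain) (hdom : s.domain = gDom B K m' M lo hi)
    (hint : EqOn s.integrand (glit B K p L e ℓ₁ ℓ₂ n₁ n₂ a) s.domain) (P : (Fin (B + 1) → ℚ) × ℚ)
    (lam : ℚ) (hA : ∀ l c, a l = some c → c.1 (Fin.last B) = lam)
    (hB : ∀ l c, (lo l = Sum.inr c ∨ hi l = Sum.inr c) → c = P ∨ c.1 (Fin.last B) = lam) :
    ∃ c ∈ AddSubgroup.closure (GGset B 2 K), KZ.of s - c ∈ KZ.relations := by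
  by_cases hP : P.1 (Fin.last B) = lam
  · refine good_of_pull s M L e p ℓ₁ ℓ₂ a lo hi h12 hbd hdom hint (fun _ => 1) (fun _ => lam)
      (fun _ => 0) (fun _ => one_ne_zero) (fun _ _ _ => ⟨rfl, rfl, rfl⟩) hA fun l c hc => Or.inl ?_
    exact (hB l c hc).elim (fun h => piv_par _ _ _ _ (h ▸ hP)) fun h => piv_par _ _ _ _ h
  · refine good_of_pull s M L e p ℓ₁ ℓ₂ a lo hi h12 hbd hdom hint (fun _ => P.1 (Fin.last B) - lam)
      (fun _ => lam) (fun _ => (fun q => P.1 (Fin.castSucc q), P.2)) (fun _ => sub_ne_zero.2 hP)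
      (fun _ _ _ => ⟨rfl, rfl, rfl⟩) hA fun l c hc => ?_
    exact (hB l c hc).elim (fun h => Or.inr (h ▸ pullC_eq_single _ _ (sub_ne_zero.2 hP) P rfl))
      fun h => Or.inl (piv_par _ _ _ _ h)

/-- **One pivot per fibre, product fibres.** If no bound is a fibre, all letters have `y`-slope
`λ` and every affine bound of the fibre `l` is either the form `P l` or `λ`-parallel, the
representation is good for `GG B 2 K`. [Kontsevich–Zagier 2001, §1.2, rule (2)] -/
theorem good_pivots {n₁ n₂ : ℕ} (s : KZ.IntegralRep (B + 1 + K))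
    (M : Fin m' → (Fin (B + 1) → ℚ) × ℚ) (L : Fin m → (Fin B → ℚ) × ℚ) (e : Fin m → ℕ)
    (p : MvPolynomial (Fin B) ℚ) (ℓ₁ ℓ₂ : (Fin B → ℚ) × ℚ)
    (a : Fin K → Option ((Fin (B + 1) → ℚ) × ℚ)) (lo hi : Fin K → Fin K ⊕ ((Fin (B + 1) → ℚ) × ℚ))
    (h12 : n₁ = 0 ∨ n₂ = 0) (hbd : Bornology.IsBounded s.domain) (hdom : s.domain = gDom B K m' M lo hi)
    (hint : EqOn s.integrand (glit B K p L e ℓ₁ ℓ₂ n₁ n₂ a) s.domain) (P : Fin K → (Fin (B + 1) → ℚ) × ℚ)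
    (lam : ℚ) (hA : ∀ l c, a l = some c → c.1 (Fin.last B) = lam)
    (hprod : ∀ l l', ¬ (lo l = Sum.inl l' ∨ hi l = Sum.inl l'))
    (hB : ∀ l c, (lo l = Sum.inr c ∨ hi l = Sum.inr c) → c = P l ∨ c.1 (Fin.last B) = lam) :
    ∃ c ∈ AddSubgroup.closure (GGset B 2 K), KZ.of s - c ∈ KZ.relations := by
  classical
  refine good_of_pull s M L e p ℓ₁ ℓ₂ a lo hi h12 hbd hdom hint
    (fun l => if (P l).1 (Fin.last B) = lam then 1 else (P l).1 (Fin.last B) - lam) (fun _ => lam)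
    (fun l => if (P l).1 (Fin.last B) = lam then 0 else (fun q => (P l).1 (Fin.castSucc q), (P l).2))
    (fun l => ?_) (fun l l' h => absurd h (hprod l l')) hA fun l c hc => ?_
  · split_ifs with h
    exacts [one_ne_zero, sub_ne_zero.2 h]
  · rcases hB l c hc with rfl | h
    · by_cases hP : (P l).1 (Fin.last B) = lam
      · rw [if_pos hP, if_pos hP]
        exact Or.inl (piv_par _ _ _ _ hP)
      · rw [if_neg hP, if_neg hP]
        exact Or.inr (pullC_eq_single _ _ (sub_ne_zero.2 hP) _ rfl)
    · exact Or.inl (piv_par _ _ _ _ h)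

end Pull

section NestSection

variable {B m m' : ℕ}

/-- Player value of a fibre. -/
@[simp] theorem pv_inl (l : Fin 2) (z : Fin (B + 1 + 2) → ℝ) :
    pv (B := B) (Sum.inl l) z = z (Fin.natAdd (B + 1) l) := rfl

/-- Player value of an affine form. -/
@[simp] theorem pv_inr (c : (Fin (B + 1) → ℚ) × ℚ) (z : Fin (B + 1 + 2) → ℝ) :
    pv (K := 2) (Sum.inr c) z = affF B 2 c z := rfl

variable {i j : Fin 2}

/-- The two fibres of a nested pair exhaust `Fin 2`. -/
theorem fin_two_eq_or (hij : i ≠ j) (l : Fin 2) : l = i ∨ l = j := by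
  fin_cases i <;> fin_cases j <;> fin_cases l <;> simp_all

/-- A statement about both fibres of a nested pair is a statement about all fibres. -/
theorem forall_fin_two_iff (hij : i ≠ j) {P : Fin 2 → Prop} : (∀ l, P l) ↔ P i ∧ P j :=
  ⟨fun h => ⟨h i, h j⟩, fun h l => (fin_two_eq_or hij l).elim (fun hl => hl ▸ h.1) fun hl => hl ▸ h.2⟩

/-- Membership in a literal two-fibre domain, read on the pair `(i, j)`. -/
theorem mem_gDom_pair (hij : i ≠ j) (M : Fin m' → (Fin (B + 1) → ℚ) × ℚ)
    (lo hi : Fin 2 → Fin 2 ⊕ ((Fin (B + 1) → ℚ) × ℚ)) (z : Fin (B + 1 + 2) → ℝ) :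
    z ∈ gDom B 2 m' M lo hi ↔ (∀ r, 0 < affF B 2 (M r) z) ∧
      (pv (lo i) z < z (Fin.natAdd (B + 1) i) ∧ z (Fin.natAdd (B + 1) i) < pv (hi i) z) ∧
      (pv (lo j) z < z (Fin.natAdd (B + 1) j) ∧ z (Fin.natAdd (B + 1) j) < pv (hi j) z) :=
  and_congr_right fun _ => forall_fin_two_iff hij

variable {n₁ n₂ : ℕ} (s : KZ.IntegralRep (B + 1 + 2)) (M : Fin m' → (Fin (B + 1) → ℚ) × ℚ)
  (L : Fin m → (Fin B → ℚ) × ℚ) (e : Fin m → ℕ) (p : MvPolynomial (Fin B) ℚ) (ℓ₁ ℓ₂ : (Fin B → ℚ) × ℚ)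
  (a : Fin 2 → Option ((Fin (B + 1) → ℚ) × ℚ)) (lo hi : Fin 2 → Fin 2 ⊕ ((Fin (B + 1) → ℚ) × ℚ))
  (h12 : n₁ = 0 ∨ n₂ = 0) (hbd : Bornology.IsBounded s.domain) (hdom : s.domain = gDom B 2 m' M lo hi)
  (hint : EqOn s.integrand (glit B 2 p L e ℓ₁ ℓ₂ n₁ n₂ a) s.domain)
  (hij : i ≠ j) (A Bd S : (Fin (B + 1) → ℚ) × ℚ) (lam : ℚ)
  (hloi : lo i = Sum.inr A) (hhii : hi i = Sum.inl j) (hloj : lo j = Sum.inl i) (hhij : hi j = Sum.inr Bd)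
  (ha : ∀ l c, a l = some c → c.1 (Fin.last B) = lam) (hS : S.1 (Fin.last B) = lam)
  (hAS : ∀ z, (∀ r, 0 < affF B 2 (M r) z) → affF B 2 A z ≤ affF B 2 S z)
  (hSB : ∀ z, (∀ r, 0 < affF B 2 (M r) z) → affF B 2 S z ≤ affF B 2 Bd z)

include hij hloi hhii hloj hhij in
/-- The nested cell, read on the pair. -/
theorem mem_nest (z : Fin (B + 1 + 2) → ℝ) : z ∈ gDom B 2 m' M lo hi ↔ (∀ r, 0 < affF B 2 (M r) z) ∧
    (affF B 2 A z < z (Fin.natAdd (B + 1) i) ∧ z (Fin.natAdd (B + 1) i) < z (Fin.natAdd (B + 1) j)) ∧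
    (z (Fin.natAdd (B + 1) i) < z (Fin.natAdd (B + 1) j) ∧ z (Fin.natAdd (B + 1) j) < affF B 2 Bd z) := by
  rw [mem_gDom_pair hij, hloi, hhii, hloj, hhij]; rfl

include hij hloi hhii hloj in
/-- The lower cell `{A < tᵢ < tⱼ < S}`, read on the pair. -/
theorem mem_nest₁ (z : Fin (B + 1 + 2) → ℝ) :
    z ∈ gDom B 2 m' M lo (Function.update hi j (Sum.inr S)) ↔ (∀ r, 0 < affF B 2 (M r) z) ∧
    (affF B 2 A z < z (Fin.natAdd (B + 1) i) ∧ z (Fin.natAdd (B + 1) i) < z (Fin.natAdd (B + 1) j)) ∧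
    (z (Fin.natAdd (B + 1) i) < z (Fin.natAdd (B + 1) j) ∧ z (Fin.natAdd (B + 1) j) < affF B 2 S z) := by
  rw [mem_gDom_pair hij, hloi, Function.update_of_ne hij, hhii, hloj, Function.update_self]; rfl

include hij hloi hhij in
/-- The middle cell `{A < tᵢ < S} × {S < tⱼ < B}`, read on the pair. -/
theorem mem_nest₂ (z : Fin (B + 1 + 2) → ℝ) :
    z ∈ gDom B 2 m' M (Function.update lo j (Sum.inr S)) (Function.update hi i (Sum.inr S)) ↔
    (∀ r, 0 < affF B 2 (M r) z) ∧
    (affF B 2 A z < z (Fin.natAdd (B + 1) i) ∧ z (Fin.natAdd (B + 1) i) < affF B 2 S z) ∧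
    (affF B 2 S z < z (Fin.natAdd (B + 1) j) ∧ z (Fin.natAdd (B + 1) j) < affF B 2 Bd z) := by
  rw [mem_gDom_pair hij, Function.update_of_ne hij, hloi, Function.update_self,
    Function.update_self, Function.update_of_ne hij.symm, hhij]; rfl

include hij hhii hloj hhij in
/-- The upper cell `{S < tᵢ < tⱼ < B}`, read on the pair. -/
theorem mem_nest₃ (z : Fin (B + 1 + 2) → ℝ) :
    z ∈ gDom B 2 m' M (Function.update lo i (Sum.inr S)) hi ↔ (∀ r, 0 < affF B 2 (M r) z) ∧
    (affF B 2 S z < z (Fin.natAdd (B + 1) i) ∧ z (Fin.natAdd (B + 1) i) < z (Fin.natAdd (B + 1) j)) ∧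
    (z (Fin.natAdd (B + 1) i) < z (Fin.natAdd (B + 1) j) ∧ z (Fin.natAdd (B + 1) j) < affF B 2 Bd z) := by
  rw [mem_gDom_pair hij, Function.update_self, hhii, Function.update_of_ne hij.symm, hloj, hhij]; rfl

include h12 hbd hdom hint hij hloi hhii hloj hhij ha hS hAS hSB in
/-- **Separable nested pair** (rules 1a + 2). A nested pair `A < tᵢ < tⱼ < B` whose letters have
the common `y`-slope `λ` and which admits a letter-parallel section `S = λ y + κ(x')` with
`A ≤ S ≤ B` on the base cell is good for `GG B 2 2`: cut by the position of `S` among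
`tᵢ < tⱼ` (the ties are null) and pull each of the three cells back along its pivots.
[Kontsevich–Zagier 2001, §1.2, rules (1), (2)] -/
theorem nestSection : (∃ c ∈ AddSubgroup.closure (GGset B 2 2), KZ.of s - c ∈ KZ.relations) := by
  -- the three cells
  set D₁ := gDom B 2 m' M lo (Function.update hi j (Sum.inr S)) with hD₁
  set D₂ := gDom B 2 m' M (Function.update lo j (Sum.inr S)) (Function.update hi i (Sum.inr S))
    with hD₂
  set D₃ := gDom B 2 m' M (Function.update lo i (Sum.inr S)) hi with hD₃
  have h₁ : D₁ ⊆ s.domain := fun z hz => by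
    rw [hdom, mem_nest M lo hi hij A Bd hloi hhii hloj hhij]
    rw [hD₁, mem_nest₁ M lo hi hij A S hloi hhii hloj] at hz
    obtain ⟨hr, ⟨hAi, hilt⟩, -, hjS⟩ := hz
    exact ⟨hr, ⟨hAi, hilt⟩, hilt, lt_of_lt_of_le hjS (hSB z hr)⟩
  have h₂ : D₂ ⊆ s.domain := fun z hz => by
    rw [hdom, mem_nest M lo hi hij A Bd hloi hhii hloj hhij]
    rw [hD₂, mem_nest₂ M lo hi hij A Bd S hloi hhij] at hz
    obtain ⟨hr, ⟨hAi, hiS⟩, hSj, hjB⟩ := hz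
    exact ⟨hr, ⟨hAi, hiS.trans hSj⟩, hiS.trans hSj, hjB⟩
  have h₃ : D₃ ⊆ s.domain := fun z hz => by
    rw [hdom, mem_nest M lo hi hij A Bd hloi hhii hloj hhij]
    rw [hD₃, mem_nest₃ M lo hi hij Bd S hhii hloj hhij] at hz
    obtain ⟨hr, ⟨hSi, hilt⟩, -, hjB⟩ := hz
    exact ⟨hr, ⟨lt_of_le_of_lt (hAS z hr) hSi, hilt⟩, hilt, hjB⟩
  -- the three restrictions
  set r₁ := s.restrict D₁ (isSemialgebraic_gDom _ _ _ _) h₁ with hr₁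
  set r₂ := s.restrict D₂ (isSemialgebraic_gDom _ _ _ _) h₂ with hr₂
  set r₃ := s.restrict D₃ (isSemialgebraic_gDom _ _ _ _) h₃ with hr₃
  set R : Fin 3 → KZ.IntegralRep (B + 1 + 2) := ![r₁, r₂, r₃] with hR
  have hRsub : ∀ k, (R k).domain ⊆ s.domain := by
    intro k; fin_cases k; exacts [h₁, h₂, h₃]
  -- the ties are null
  have hN : volume ({z : Fin (B + 1 + 2) → ℝ | z (Fin.natAdd (B + 1) i) = affF B 2 S z} ∪
      {z | z (Fin.natAdd (B + 1) j) = affF B 2 S z}) = 0 :=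
    measure_union_null (volume_fibre_eq_affF i S) (volume_fibre_eq_affF j S)
  have hcov : s.domain \ (⋃ k ∈ (Finset.univ : Finset (Fin 3)), (R k).domain) ⊆
      {z : Fin (B + 1 + 2) → ℝ | z (Fin.natAdd (B + 1) i) = affF B 2 S z} ∪
      {z | z (Fin.natAdd (B + 1) j) = affF B 2 S z} := by
    rintro z ⟨hz, hzU⟩
    have hnot : ∀ k, z ∉ (R k).domain := fun k hk => hzU (mem_iUnion₂.2 ⟨k, Finset.mem_univ _, hk⟩)
    rw [hdom, mem_nest M lo hi hij A Bd hloi hhii hloj hhij] at hz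
    obtain ⟨hr, ⟨hAi, hilt⟩, -, hjB⟩ := hz
    rcases lt_trichotomy (z (Fin.natAdd (B + 1) j)) (affF B 2 S z) with hj | hj | hj
    · exact absurd ((mem_nest₁ M lo hi hij A S hloi hhii hloj z).2 ⟨hr, ⟨hAi, hilt⟩, hilt, hj⟩) (hnot 0)
    · exact Or.inr hj
    rcases lt_trichotomy (z (Fin.natAdd (B + 1) i)) (affF B 2 S z) with hi' | hi' | hi'
    · exact absurd ((mem_nest₂ M lo hi hij A Bd S hloi hhij z).2 ⟨hr, ⟨hAi, hi'⟩, hj, hjB⟩) (hnot 1)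
    · exact Or.inl hi'
    · exact absurd ((mem_nest₃ M lo hi hij Bd S hhii hloj hhij z).2 ⟨hr, ⟨hi', hilt⟩, hilt, hjB⟩)
        (hnot 2)
  -- the cells are disjoint
  have hdisj : ∀ k k' : Fin 3, k ≠ k' → (R k).domain ∩ (R k').domain = ∅ := by
    have d12 : D₁ ∩ D₂ = ∅ := eq_empty_of_forall_notMem fun z ⟨hz, hz'⟩ => by
      rw [hD₁, mem_nest₁ M lo hi hij A S hloi hhii hloj] at hz
      rw [hD₂, mem_nest₂ M lo hi hij A Bd S hloi hhij] at hz'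
      linarith [hz.2.2.2, hz'.2.2.1]
    have d13 : D₁ ∩ D₃ = ∅ := eq_empty_of_forall_notMem fun z ⟨hz, hz'⟩ => by
      rw [hD₁, mem_nest₁ M lo hi hij A S hloi hhii hloj] at hz
      rw [hD₃, mem_nest₃ M lo hi hij Bd S hhii hloj hhij] at hz'
      linarith [hz.2.2.2, hz'.2.1.1, hz'.2.1.2]
    have d23 : D₂ ∩ D₃ = ∅ := eq_empty_of_forall_notMem fun z ⟨hz, hz'⟩ => by
      rw [hD₂, mem_nest₂ M lo hi hij A Bd S hloi hhij] at hz
      rw [hD₃, mem_nest₃ M lo hi hij Bd S hhii hloj hhij] at hz'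
      linarith [hz.2.1.2, hz'.2.1.1]
    intro k k' hkk'
    fin_cases k <;> fin_cases k' <;> first | exact absurd rfl hkk' | exact d12 | exact d13 | exact d23 |
      (rw [inter_comm]; first | exact d12 | exact d13 | exact d23)
  -- rule (1a)
  have hrel : KZ.of s - ∑ k, KZ.of (R k) ∈ KZ.relations := by
    refine KZ.of_sub_sum_of_mem_relations Finset.univ s R (fun k _ => ?_) (fun k _ z _ => ?_)
      (measure_mono_null hcov hN) (fun k _ k' _ hkk' => ?_)
    · rw [sdiff_eq_empty.2 (hRsub k), measure_empty]
    · fin_cases k <;> rfl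
    · show volume ((R k).domain ∩ (R k').domain) = 0
      rw [hdisj k k' hkk', measure_empty]
  -- the three cells are good
  refine good_of_sub_mem hrel (good_sum _ _ fun k _ => ?_)
  fin_cases k
  · refine good_pivot r₁ M L e p ℓ₁ ℓ₂ a lo _ h12 (hbd.subset h₁) rfl (hint.mono h₁) A lam ha
      fun l c hc => ?_
    rcases fin_two_eq_or hij l with rfl | rfl
    · rw [hloi, Function.update_of_ne hij, hhii] at hc
      rcases hc with hc | hc <;> cases hc; exact Or.inl rfl
    · rw [hloj, Function.update_self] at hc
      rcases hc with hc | hc <;> cases hc; exact Or.inr hS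
  · classical
    refine good_pivots r₂ M L e p ℓ₁ ℓ₂ a _ _ h12 (hbd.subset h₂) rfl (hint.mono h₂)
      (fun l => if l = i then A else Bd) lam ha (fun l l' hl => ?_) fun l c hc => ?_
    · rcases fin_two_eq_or hij l with rfl | rfl
      · rw [Function.update_of_ne hij, hloi, Function.update_self] at hl
        rcases hl with hl | hl <;> cases hl
      · rw [Function.update_self, Function.update_of_ne hij.symm, hhij] at hl
        rcases hl with hl | hl <;> cases hl
    · rcases fin_two_eq_or hij l with rfl | rfl
      · rw [Function.update_of_ne hij, hloi, Function.update_self] at hc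
        rcases hc with hc | hc <;> cases hc
        exacts [Or.inl (if_pos rfl).symm, Or.inr hS]
      · rw [Function.update_self, Function.update_of_ne hij.symm, hhij] at hc
        rcases hc with hc | hc <;> cases hc
        exacts [Or.inr hS, Or.inl (if_neg hij.symm).symm]
  · refine good_pivot r₃ M L e p ℓ₁ ℓ₂ a _ hi h12 (hbd.subset h₃) rfl (hint.mono h₃) Bd lam ha
      fun l c hc => ?_
    rcases fin_two_eq_or hij l with rfl | rfl
    · rw [Function.update_self, hhii] at hc
      rcases hc with hc | hc <;> cases hc; exact Or.inr hS
    · rw [Function.update_of_ne hij.symm, hloj, hhij] at hc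
      rcases hc with hc | hc <;> cases hc; exact Or.inl rfl

end NestSection

end RebaseNest

/-- **Registered part of `stub_rebaseSimpleZero` / `rebaseSimpleZero_nested2` (line `janus-bands`,
v6.2): separable nested pair.** A representation with the literal `GG B σ 2` datum whose two
fibres are nested (`A < tᵢ < tⱼ < B`), whose letters have a common `y`-slope `λ` (`ha`) and
which admits a letter-parallel section `S` (`hS`) with `A ≤ S ≤ B` on the base cell (`hAS`,
`hSB`) is congruent modulo `KZ.relations` to the subgroup generated by the literal class
`GG B 2 2` (`RebaseNest.nestSection`). [Kontsevich–Zagier 2001, §1.2, rules (1), (2)] -/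
theorem rebaseSimpleZero_nestedSection (B m m' n₁ n₂ : ℕ) (s : KZ.IntegralRep (B + 1 + 2)) (M : Fin m' → (Fin (B + 1) → ℚ) × ℚ) (L : Fin m → (Fin B → ℚ) × ℚ) (e : Fin m → ℕ) (p : MvPolynomial (Fin B) ℚ) (ℓ₁ ℓ₂ : (Fin B → ℚ) × ℚ) (a : Fin 2 → Option ((Fin (B + 1) → ℚ) × ℚ)) (lo hi : Fin 2 → Fin 2 ⊕ ((Fin (B + 1) → ℚ) × ℚ)) (h12 : n₁ = 0 ∨ n₂ = 0) (hbd : Bornology.IsBounded s.domain) (hdom : s.domain = {z | (∀ j, 0 < ∑ i, ((M j).1 i : ℝ) * z (Fin.castAdd 2 i) + ((M j).2 : ℝ)) ∧ ∀ i, Sum.elim (fun j => z (Fin.natAdd (B + 1) j)) (fun c => ∑ i', (c.1 i' : ℝ) * z (Fin.castAdd 2 i') + (c.2 : ℝ)) (lo i) < z (Fin.natAdd (B + 1) i) ∧ z (Fin.natAdd (B + 1) i) < Sum.elim (fun j => z (Fin.natAdd (B + 1) j)) (fun c => ∑ i', (c.1 i' : ℝ) * z (Fin.castAdd 2 i') +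 (c.2 : ℝ)) (hi i)}) (hint : EqOn s.integrand (fun z => MvPolynomial.aeval (fun i => z (Fin.castAdd 2 (Fin.castSucc i))) p / (∏ j, (∑ i, ((L j).1 i : ℝ) * z (Fin.castAdd 2 (Fin.castSucc i)) + ((L j).2 : ℝ)) ^ e j) * ((z (Fin.castAdd 2 (Fin.last B)) - (∑ i, (ℓ₁.1 i : ℝ) * z (Fin.castAdd 2 (Fin.castSucc i)) + (ℓ₁.2 : ℝ))) ^ n₁ / (z (Fin.castAdd 2 (Fin.last B)) - (∑ i, (ℓ₂.1 i : ℝ) * z (Fin.castAdd 2 (Fin.castSucc i)) + (ℓ₂.2 : ℝ))) ^ n₂) * ∏ i, (a i).elim 1 (fun c => 1 / (z (Fin.natAdd (B + 1) i) - (∑ i', (c.1 i' : ℝ) * z (Fin.castAdd 2 i') + (c.2 : ℝ))))) s.domain) (i j : Fin 2) (hij : i ≠ j) (A Bd S : (Fin (B + 1) → ℚ) × ℚ) (lam : ℚ) (hloi : lo i = Sum.inr A) (hhii : hi i = Sum.inl j) (hloj : lo j = Sum.inl i) (hhij : hi j = Sum.inr Bd) (ha : ∀ l c, a l = some c → c.1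 (Fin.last B) = lam) (hS : S.1 (Fin.last B) = lam) (hAS : ∀ z : Fin (B + 1 + 2) → ℝ, (∀ r, 0 < ∑ i, ((M r).1 i : ℝ) * z (Fin.castAdd 2 i) + ((M r).2 : ℝ)) → (∑ i', (A.1 i' : ℝ) * z (Fin.castAdd 2 i') + (A.2 : ℝ)) ≤ (∑ i', (S.1 i' : ℝ) * z (Fin.castAdd 2 i') + (S.2 : ℝ))) (hSB : ∀ z : Fin (B + 1 + 2) → ℝ, (∀ r, 0 < ∑ i, ((M r).1 i : ℝ) * z (Fin.castAdd 2 i) + ((M r).2 : ℝ)) → (∑ i', (S.1 i' : ℝ) * z (Fin.castAdd 2 i') + (S.2 : ℝ)) ≤ (∑ i', (Bd.1 i' : ℝ) * z (Fin.castAdd 2 i') + (Bd.2 : ℝ))) : ∃ c ∈ AddSubgroup.closure {w : KZ.FormalRep | ∃ (m m' n₁ n₂ : ℕ) (s : KZ.IntegralRep (B + 1 + 2)) (M : Fin m' → (Fin (B + 1) → ℚ) × ℚ) (L : Fin m → (Fin B → ℚ) × ℚ) (e : Fin m → ℕ) (p : MvPolynomial (Fin B) ℚ) (ℓ₁ ℓ₂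 : (Fin B → ℚ) × ℚ) (a : Fin 2 → Option ((Fin (B + 1) → ℚ) × ℚ)) (lo hi : Fin 2 → Fin 2 ⊕ ((Fin (B + 1) → ℚ) × ℚ)), (n₁ = 0 ∨ n₂ = 0) ∧ (2 = 2 → (∀ i c, a i = some c → c.1 (Fin.last B) = 0) ∧ (∀ i c, (lo i = Sum.inr c ∨ hi i = Sum.inr c) → (c.1 (Fin.last B) = 0 ∨ c = (Pi.single (Fin.last B) 1, 0)))) ∧ Bornology.IsBounded s.domain ∧ s.domain = {z | (∀ j, 0 < ∑ i, ((M j).1 i : ℝ) * z (Fin.castAdd 2 i) + ((M j).2 : ℝ)) ∧ ∀ i, Sum.elim (fun j => z (Fin.natAdd (B + 1) j)) (fun c => ∑ i', (c.1 i' : ℝ) * z (Fin.castAdd 2 i') + (c.2 : ℝ)) (lo i) < z (Fin.natAdd (B + 1) i) ∧ z (Fin.natAdd (B + 1) i) < Sum.elim (fun j => z (Fin.natAdd (B + 1) j)) (fun c => ∑ i', (c.1 i' : ℝ) * z (Fin.castAdd 2 i') + (c.2 : ℝ)) (hi i)} ∧ EqOn s.integrand (fun z => MvPolynomial.aeval (fun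 i => z (Fin.castAdd 2 (Fin.castSucc i))) p / (∏ j, (∑ i, ((L j).1 i : ℝ) * z (Fin.castAdd 2 (Fin.castSucc i)) + ((L j).2 : ℝ)) ^ e j) * ((z (Fin.castAdd 2 (Fin.last B)) - (∑ i, (ℓ₁.1 i : ℝ) * z (Fin.castAdd 2 (Fin.castSucc i)) + (ℓ₁.2 : ℝ))) ^ n₁ / (z (Fin.castAdd 2 (Fin.last B)) - (∑ i, (ℓ₂.1 i : ℝ) * z (Fin.castAdd 2 (Fin.castSucc i)) + (ℓ₂.2 : ℝ))) ^ n₂) * ∏ i, (a i).elim 1 (fun c => 1 / (z (Fin.natAdd (B + 1) i) - (∑ i', (c.1 i' : ℝ) * z (Fin.castAdd 2 i') + (c.2 : ℝ))))) s.domain ∧ w = KZ.of s}, KZ.of s - c ∈ KZ.relations :=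
  RebaseNest.nestSection s M L e p ℓ₁ ℓ₂ a lo hi h12 hbd hdom hint hij A Bd S lam hloi hhii hloj hhij ha hS
    hAS hSB

end Summit.KontsevichZagierPeriods.ArrangementNormalForm.JanusBands
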